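import Summits.KontsevichZagierPeriods.KontsevichZagierPeriods.Theorems.SoloBlindBeta
import Summits.KontsevichZagierPeriods.KontsevichZagierPeriods.Theorems.SoloBlindDimLeOne
import Mathlib.NumberTheory.Niven
import HarnessLib

/-!
# The reflection formula inside Kontsevich–Zagier's three rules

**Theorem (reflection by moves).** For naturals `0 < p < n`, in the formal period ring
`Q = FormalRep ⧸ relations`,

  `β(p/n, 1 - p/n) = (1 / sin(π p/n)) • x_π`        (`betaQ_reflection`),

i.e. Euler's reflection formula `Γ(a)Γ(1-a) = π / sin(πa)` at every rational `a ∈ (0,1)` is a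
consequence of the three rules. The chain of moves: ONE change of variables `t = vⁿ/(1+vⁿ)` from
`(0,∞)` onto `(0,1)` turns `β(p/n, 1-p/n) = [(0,1), t^{p/n-1}(1-t)^{-p/n}]` into the ℚ-RATIONAL
one-dimensional representation `R_{p,n} = [(0,∞), n v^{p-1}/(1+vⁿ)]` (`reflRep`,
`reflRep_sub_betaRep`); every rational representation of dimension one is a cell sum
(`isCellSum_of_isRational_of_le_one`, the dimension-`≤ 1` normal form of `SoloBlindReduction`), and
on cell sums `eval` is injective modulo the rules (`mem_relations_of_isCellSum_of_eval_eq_zero`,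
Baker); the value `π / sin(π p/n)` (Mathlib's `Real.Gamma_mul_Gamma_one_sub`) has the rational
representative `[(0,1), d/(1+x²)]`, `d = 4/sin(πp/n) ∈ ℚ̄` (`Real.isAlgebraic_sin_rat_mul_pi`).

Corollaries: `β(¼,¾) = √2 • x_π`, `β(⅓,⅔) = (2/√3) • x_π` (`betaQ_reflection_quarter`,
`betaQ_reflection_third`).

References: M. Kontsevich, D. Zagier, *Periods* (2001), §1.2; A. Baker, *Transcendental number
theory* (1975), Thm 2.1 (through `SoloBlindInjective`).
-/

noncomputable section

namespace Summit.KontsevichZagierPeriods.KontsevichZagierPeriods.Theorems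

open Set MeasureTheory
open Literature.ModelTheory.ExponentialFields (IsSemialgebraic)
open Literature.NumberTheory.Transcendental
open Literature.NumberTheory.Transcendental.KZ
open Literature.Analysis.SpecialFunctions.Selberg

namespace SoloBlind

/-! ## The chart `t = vⁿ/(1+vⁿ)` -/

section chart

variable {n : ℕ}

/-- `1 + vⁿ > 0` for `v ≥ 0`. -/
theorem one_add_pow_pos' {v : ℝ} (hv : 0 ≤ v) (n : ℕ) : (0:ℝ) < 1 + v ^ n := by positivity

/-- The derivative of `v ↦ vⁿ/(1+vⁿ)` at `v > 0` is `n v^{n-1}/(1+vⁿ)²`. -/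
theorem hasDerivAt_powChart (n : ℕ) {v : ℝ} (hv : 0 < v) :
    HasDerivAt (fun u : ℝ => u ^ n / (1 + u ^ n)) (n * v ^ (n - 1) / (1 + v ^ n) ^ 2) v := by
  have h1 := one_add_pow_pos' hv.le n
  have hn : HasDerivAt (fun u : ℝ => u ^ n) (n * v ^ (n - 1)) v := hasDerivAt_pow n v
  have hd : HasDerivAt (fun u : ℝ => 1 + u ^ n) (n * v ^ (n - 1)) v := by
    simpa using (hasDerivAt_pow n v).const_add 1
  refine (hn.div hd h1.ne').congr_deriv ?_
  rw [div_left_inj' (pow_ne_zero 2 h1.ne')]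
  ring

/-- `v ↦ vⁿ/(1+vⁿ)` is injective on `(0,∞)` for `n ≠ 0`. -/
theorem injOn_powChart (hn : n ≠ 0) : InjOn (fun u : ℝ => u ^ n / (1 + u ^ n)) (Ioi 0) := by
  intro u hu v hv huv
  have hu' : (0:ℝ) < u := hu
  have hv' : (0:ℝ) < v := hv
  have h1 := one_add_pow_pos' hu'.le n
  have h2 := one_add_pow_pos' hv'.le n
  have e : u ^ n / (1 + u ^ n) = v ^ n / (1 + v ^ n) := huv
  rw [div_eq_div_iff h1.ne' h2.ne'] at e
  have e2 : u ^ n = v ^ n := by linear_combination e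
  exact (pow_left_inj₀ hu'.le hv'.le hn).mp e2

/-- `v ↦ vⁿ/(1+vⁿ)` maps `(0,∞)` onto `(0,1)` for `n ≠ 0`. -/
theorem image_powChart (hn : n ≠ 0) :
    Ioo (0:ℝ) 1 = (fun u : ℝ => u ^ n / (1 + u ^ n)) '' Ioi 0 := by
  ext t
  constructor
  · rintro ⟨ht0, ht1⟩
    have h1t : 0 < 1 - t := by linarith
    have hq : 0 < t / (1 - t) := div_pos ht0 h1t
    refine ⟨(t / (1 - t)) ^ ((n : ℝ)⁻¹), Real.rpow_pos_of_pos hq _, ?_⟩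
    show ((t / (1 - t)) ^ ((n : ℝ)⁻¹)) ^ n / (1 + ((t / (1 - t)) ^ ((n : ℝ)⁻¹)) ^ n) = t
    rw [Real.rpow_inv_natCast_pow hq.le hn]
    have h1t' : (1:ℝ) - t ≠ 0 := h1t.ne'
    field_simp
    ring
  · rintro ⟨u, hu, rfl⟩
    have hu' : (0:ℝ) < u := hu
    have h1 := one_add_pow_pos' hu'.le n
    exact ⟨div_pos (pow_pos hu' n) h1, (div_lt_one h1).mpr (by linarith)⟩

/-- `v ↦ vⁿ/(1+vⁿ)` is a `ℚ`-semialgebraic function on the half-line. -/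
theorem isSemialgebraicFunOn_powChart (n : ℕ) :
    IsSemialgebraicFunOn ℚ (line (Ioi (0:ℝ))) (fun x => (x 0) ^ n / (1 + (x 0) ^ n)) := by
  have h := isSemialgebraicFunOn_aeval_div_aeval (isSemialgebraic_line_Ioi isAlgebraic_zero)
    (MvPolynomial.X 0 ^ n) (1 + MvPolynomial.X 0 ^ n : MvPolynomial (Fin 1) ℚ) (fun x hx => by
      have hx' : (0:ℝ) < x 0 := hx
      have : (0:ℝ) < 1 + x 0 ^ n := by positivity
      simpa using this.ne')
  refine h.congr fun x _ => ?_
  simp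

/-- **The pull-back identity** of the chart `t = vⁿ/(1+vⁿ)` for the exponents `(p/n, 1-p/n)`:
`t^{p/n-1}(1-t)^{-p/n} |dt/dv| = n v^{p-1}/(1+vⁿ)` (`v > 0`, `0 < p`, `0 < n`). -/
theorem powChart_pullback {p n : ℕ} (hp : 0 < p) (hn : 0 < n) {v : ℝ} (hv : 0 < v) :
    (n : ℝ) * v ^ (p - 1) / (1 + v ^ n) =
      (v ^ n / (1 + v ^ n)) ^ ((p : ℝ) / n - 1) *
        (1 - v ^ n / (1 + v ^ n)) ^ ((1 - (p : ℝ) / n) - 1) *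
          |n * v ^ (n - 1) / (1 + v ^ n) ^ 2| := by
  have hA := one_add_pow_pos' hv.le n
  have hV : 0 < v ^ n := pow_pos hv n
  have hn0 : (n : ℝ) ≠ 0 := Nat.cast_ne_zero.mpr hn.ne'
  have h1t : 1 - v ^ n / (1 + v ^ n) = 1 / (1 + v ^ n) := by
    field_simp
    ring
  have R1 : (v ^ n) ^ ((p : ℝ) / n - 1) * v ^ (n - 1) = v ^ (p - 1) := by
    rw [← Real.rpow_natCast v n, ← Real.rpow_mul hv.le, ← Real.rpow_natCast v (n - 1),
      ← Real.rpow_add hv, ← Real.rpow_natCast v (p - 1)]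
    congr 1
    rw [Nat.cast_sub (by omega : 1 ≤ n), Nat.cast_sub (by omega : 1 ≤ p)]
    field_simp
    ring
  have R2 : (1 + v ^ n) ^ ((p : ℝ) / n - 1) * (1 + v ^ n) ^ ((1 - (p : ℝ) / n) - 1) =
      (1 + v ^ n)⁻¹ := by
    rw [← Real.rpow_add hA, ← Real.rpow_neg_one]
    congr 1
    ring
  have hY : 0 < (1 + v ^ n) ^ ((p : ℝ) / n - 1) := Real.rpow_pos_of_pos hA _
  have hZ : 0 < (1 + v ^ n) ^ ((1 - (p : ℝ) / n) - 1) := Real.rpow_pos_of_pos hA _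
  rw [h1t, Real.div_rpow hV.le hA.le, Real.div_rpow zero_le_one hA.le, Real.one_rpow,
    abs_of_nonneg (by positivity)]
  rw [show (v ^ n) ^ ((p : ℝ) / n - 1) / (1 + v ^ n) ^ ((p : ℝ) / n - 1) *
      (1 / (1 + v ^ n) ^ ((1 - (p : ℝ) / n) - 1)) * (n * v ^ (n - 1) / (1 + v ^ n) ^ 2) =
      ((v ^ n) ^ ((p : ℝ) / n - 1) * v ^ (n - 1)) * n /
        (((1 + v ^ n) ^ ((p : ℝ) / n - 1) * (1 + v ^ n) ^ ((1 - (p : ℝ) / n) - 1)) *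
          (1 + v ^ n) ^ 2) by
    field_simp]
  rw [R1, R2]
  field_simp

end chart

/-! ## The rational representation `R_{p,n} = [(0,∞), n v^{p-1}/(1+vⁿ)]` -/

section reflRep

variable {p n : ℕ}

/-- The exponent `p/n` as a rational, cast to `ℝ`. -/
theorem ratCast_div_natCast (p n : ℕ) : (((p : ℚ) / n : ℚ) : ℝ) = (p : ℝ) / n := by
  push_cast
  ring

/-- `n v^{p-1}/(1+vⁿ)` is integrable on `(0,∞)` for `0 < p < n`: it is the pull-back of the
integrable Beta integrand `t^{p/n-1}(1-t)^{-p/n}` along the chart `t = vⁿ/(1+vⁿ)`. -/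
theorem integrableOn_reflIntegrand (hp : 0 < p) (hpn : p < n) :
    IntegrableOn (fun v : ℝ => (n : ℝ) * v ^ (p - 1) / (1 + v ^ n)) (Ioi 0) := by
  have hn : 0 < n := lt_of_le_of_lt (Nat.zero_le p) hpn
  have ha : (0:ℝ) < (p : ℝ) / n := div_pos (Nat.cast_pos.mpr hp) (Nat.cast_pos.mpr hn)
  have hb : (0:ℝ) < 1 - (p : ℝ) / n := by
    rw [sub_pos, div_lt_one (Nat.cast_pos.mpr hn)]
    exact_mod_cast hpn
  have hg := (integrableOn_Ioo_rpow_mul_one_sub_rpow_and_integral_eq ha hb).1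
  rw [image_powChart hn.ne'] at hg
  have h := (integrableOn_image_iff_integrableOn_abs_deriv_smul measurableSet_Ioi
    (fun v hv => (hasDerivAt_powChart n hv).hasDerivWithinAt) (injOn_powChart hn.ne') _).mp hg
  refine h.congr_fun (fun v hv => ?_) measurableSet_Ioi
  have hv' : (0:ℝ) < v := hv
  simp only [smul_eq_mul]
  rw [powChart_pullback hp hn hv']
  ring

/-- **`R_{p,n} = [(0,∞), n v^{p-1}/(1+vⁿ)]`**, a ℚ-rational one-dimensional representation of
`π / sin(π p/n)` (`0 < p < n`). -/
def reflRep (p n : ℕ) (hp : 0 < p) (hpn : p < n) : IntegralRep 1 :=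
  lineRep (Ioi 0) (fun v => (n : ℝ) * v ^ (p - 1) / (1 + v ^ n))
    (isSemialgebraic_line_Ioi isAlgebraic_zero)
    ((isSemialgebraicFunOn_aeval_div_aeval (isSemialgebraic_line_Ioi isAlgebraic_zero)
      (MvPolynomial.C (n : ℚ) * MvPolynomial.X 0 ^ (p - 1))
      (1 + MvPolynomial.X 0 ^ n : MvPolynomial (Fin 1) ℚ) (fun x hx => by
        have hx' : (0:ℝ) < x 0 := hx
        have : (0:ℝ) < 1 + x 0 ^ n := by positivity
        simpa using this.ne')).congr fun x _ => by simp)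
    (integrableOn_reflIntegrand hp hpn)

variable {hp : 0 < p} {hpn : p < n}

/-- The domain of `R_{p,n}`. -/
@[simp] theorem reflRep_domain : (reflRep p n hp hpn).domain = line (Ioi 0) := rfl

/-- The integrand of `R_{p,n}`. -/
@[simp] theorem reflRep_integrand :
    (reflRep p n hp hpn).integrand = fun x => (n : ℝ) * (x 0) ^ (p - 1) / (1 + (x 0) ^ n) :=
  rfl

/-- `R_{p,n}` has Kontsevich–Zagier's literal rational shape. -/
theorem isRational_reflRep : (reflRep p n hp hpn).IsRational :=
  ⟨MvPolynomial.C (n : ℚ) * MvPolynomial.X 0 ^ (p - 1), 1 + MvPolynomial.X 0 ^ n,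
    fun x hx => by
      have hx' : (0:ℝ) < x 0 := hx
      have : (0:ℝ) < 1 + x 0 ^ n := by positivity
      simpa using this.ne',
    fun x _ => by simp⟩

/-- The positivity hypotheses of `β(p/n, 1-p/n)`. -/
theorem refl_exponents_pos (hp : 0 < p) (hpn : p < n) :
    (0:ℚ) < (p : ℚ) / n ∧ (0:ℚ) < 1 - (p : ℚ) / n := by
  have hn : 0 < n := lt_of_le_of_lt (Nat.zero_le p) hpn
  refine ⟨div_pos (Nat.cast_pos.mpr hp) (Nat.cast_pos.mpr hn), ?_⟩
  rw [sub_pos, div_lt_one (Nat.cast_pos.mpr hn)]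
  exact_mod_cast hpn

/-- **`R_{p,n} ≡ β(p/n, 1-p/n)`** by the change of variables `t = vⁿ/(1+vⁿ)`. -/
theorem reflRep_sub_betaRep (hp : 0 < p) (hpn : p < n) :
    of (reflRep p n hp hpn) -
      of (betaRep ((p : ℚ) / n) (1 - (p : ℚ) / n) (refl_exponents_pos hp hpn).1
        (refl_exponents_pos hp hpn).2) ∈ relations := by
  have hn : 0 < n := lt_of_le_of_lt (Nat.zero_le p) hpn
  unfold reflRep betaRep
  refine lineRep_subst (fun u => u ^ n / (1 + u ^ n)) (fun u => n * u ^ (n - 1) / (1 + u ^ n) ^ 2)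
    (isSemialgebraicFunOn_powChart n) (fun v hv => (hasDerivAt_powChart n hv).hasDerivWithinAt)
    (injOn_powChart hn.ne') (image_powChart hn.ne') fun v hv => ?_
  have hv' : (0:ℝ) < v := hv
  rw [ratCast_div_natCast, show (((1 - (p : ℚ) / n : ℚ) : ℝ)) = 1 - (p : ℝ) / n by push_cast; ring]
  exact powChart_pullback hp hn hv'

/-- The value of `R_{p,n}` is `π / sin(π p/n)`. -/
theorem reflRep_value (hp : 0 < p) (hpn : p < n) :
    (reflRep p n hp hpn).value = Real.pi / Real.sin (Real.pi * ((p : ℝ) / n)) := by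
  have h := (AddMonoidHom.mem_ker).1
    ((show relations ≤ eval.ker from KZ.relations_le_ker_eval_holds) (reflRep_sub_betaRep hp hpn))
  rw [map_sub, eval_of, eval_of, sub_eq_zero] at h
  rw [h, betaRep_value, ratCast_div_natCast,
    show (((1 - (p : ℚ) / n : ℚ) : ℝ)) = 1 - (p : ℝ) / n by push_cast; ring,
    show (p : ℝ) / n + (1 - (p : ℝ) / n) = 1 by ring, Real.Gamma_one, div_one,
    Real.Gamma_mul_Gamma_one_sub]

end reflRep

/-! ## The reflection formula in `Q` -/

section reflection

variable {p n : ℕ}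

/-- `1 / sin(π p/n)` is a real algebraic number. -/
theorem isAlgebraic_inv_sin (p n : ℕ) :
    IsAlgebraic ℚ (Real.sin (Real.pi * ((p : ℝ) / n)))⁻¹ := by
  have h := (Real.isAlgebraic_sin_rat_mul_pi ((p : ℚ) / n)).extendScalars
    (R := ℤ) (S := ℚ) (A := ℝ) (RingHom.injective_int (algebraMap ℤ ℚ))
  rw [show (((p : ℚ) / n : ℚ) : ℝ) * Real.pi = Real.pi * ((p : ℝ) / n) by push_cast; ring] at h
  exact h.inv

/-- `sin(π p/n) > 0` for `0 < p < n`. -/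
theorem sin_pos_of_lt {p n : ℕ} (hp : 0 < p) (hpn : p < n) :
    0 < Real.sin (Real.pi * ((p : ℝ) / n)) := by
  have hn : (0:ℝ) < n := Nat.cast_pos.mpr (lt_of_le_of_lt (Nat.zero_le p) hpn)
  have h1 : (p : ℝ) / n < 1 := (div_lt_one hn).mpr (by exact_mod_cast hpn)
  have h0 : 0 < (p : ℝ) / n := div_pos (Nat.cast_pos.mpr hp) hn
  apply Real.sin_pos_of_pos_of_lt_pi
  · positivity
  · nlinarith [Real.pi_pos]

/-- The reflection coefficient `1 / sin(π p/n) ∈ K₀ = ℚ̄ ∩ ℝ`. -/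
def reflCoeff (p n : ℕ) : K₀ :=
  ⟨(Real.sin (Real.pi * ((p : ℝ) / n)))⁻¹, mem_K₀_iff.mpr (isAlgebraic_inv_sin p n)⟩

/-- The value of the reflection coefficient. -/
@[simp] theorem coe_reflCoeff (p n : ℕ) :
    ((reflCoeff p n : K₀) : ℝ) = (Real.sin (Real.pi * ((p : ℝ) / n)))⁻¹ := rfl

/-- **`[R_{p,n}] = (1/sin(π p/n)) • x_π`** in `Q`: the rational representation `R_{p,n}` is a cell
sum of value `π/sin(πp/n) = d · arctan 1`, `d = 4/sin(πp/n)` algebraic, so it is equivalent to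
the cell `[(0,1), d/(1+x²)]` by the injectivity of `eval` on cell sums. -/
theorem mkQ_reflRep (hp : 0 < p) (hpn : p < n) :
    mkQ (of (reflRep p n hp hpn)) = reflCoeff p n • xPi := by
  set s : ℝ := Real.sin (Real.pi * ((p : ℝ) / n)) with hs
  have hs0 : 0 < s := sin_pos_of_lt hp hpn
  have h4 : IsAlgebraic ℚ (4:ℝ) := by simpa using isAlgebraic_nat (R := ℚ) (A := ℝ) 4
  have hd : IsAlgebraic ℚ (4 * s⁻¹) := h4.mul (isAlgebraic_inv_sin p n)
  have hz : IsCellSum (of (reflRep p n hp hpn) - of (atanCell (4 * s⁻¹) 1 hd isAlgebraic_one)) :=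
    (isCellSum_of_isRational_of_le_one _ le_rfl isRational_reflRep).sub
      (isCellSum_atanCell _ _ hd isAlgebraic_one zero_le_one)
  have h0 : eval (of (reflRep p n hp hpn) - of (atanCell (4 * s⁻¹) 1 hd isAlgebraic_one)) = 0 := by
    rw [map_sub, eval_of, eval_of, reflRep_value, value_atanCell zero_le_one, Real.arctan_one,
      ← hs]
    field_simp
    ring
  have hrel := mem_relations_of_isCellSum_of_eval_eq_zero hz h0
  rw [← mkQ_eq_mkQ_iff] at hrel
  rw [hrel, mkQ_atanCell hd isAlgebraic_one, xPi, smul_smul]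
  congr 1
  apply Subtype.ext
  show 4 * s⁻¹ = ((reflCoeff p n * 4 : K₀) : ℝ)
  rw [IntermediateField.coe_mul, coe_reflCoeff, ← hs, show ((4 : K₀) : ℝ) = 4 from rfl]
  ring

/-- **The reflection formula inside the rules.** For `0 < p < n`,
`β(p/n, 1-p/n) = (1/sin(π p/n)) • x_π` in `Q = FormalRep ⧸ relations`. -/
theorem betaQ_reflection (hp : 0 < p) (hpn : p < n) :
    betaQ ((p : ℚ) / n) (1 - (p : ℚ) / n) = reflCoeff p n • xPi := by
  rw [← mkQ_reflRep hp hpn, betaQ_eq (refl_exponents_pos hp hpn).1 (refl_exponents_pos hp hpn).2,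
    eq_comm, mkQ_eq_mkQ_iff]
  exact reflRep_sub_betaRep hp hpn

/-- `evalQ` of the reflection formula: `Γ(p/n)Γ(1-p/n) = π/sin(πp/n)` (a consistency check). -/
theorem evalQ_betaQ_reflection (hp : 0 < p) (hpn : p < n) :
    evalQ (betaQ ((p : ℚ) / n) (1 - (p : ℚ) / n)) =
      Real.pi / Real.sin (Real.pi * ((p : ℝ) / n)) := by
  rw [betaQ_reflection hp hpn, evalQ_smul, evalQ_xPi, coe_reflCoeff, inv_mul_eq_div]

end reflection

/-! ## Two instances -/

/-- **`β(¼,¾) = (1/sin(π/4)) • x_π`** (`Γ(¼)Γ(¾) = π√2` inside the rules). -/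
theorem betaQ_reflection_quarter : betaQ (1 / 4) (3 / 4) = reflCoeff 1 4 • xPi := by
  have h := betaQ_reflection (p := 1) (n := 4) one_pos (by norm_num)
  norm_num at h
  exact h

/-- The coefficient at `(1,4)` is `√2`. -/
theorem coe_reflCoeff_one_four : ((reflCoeff 1 4 : K₀) : ℝ) = Real.sqrt 2 := by
  rw [coe_reflCoeff, show Real.pi * (((1:ℕ) : ℝ) / ((4:ℕ) : ℝ)) = Real.pi / 4 by
    push_cast; ring, Real.sin_pi_div_four]
  have h2 : Real.sqrt 2 ≠ 0 := by positivity
  have h22 : Real.sqrt 2 * Real.sqrt 2 = 2 := Real.mul_self_sqrt (by norm_num)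
  field_simp
  linarith [h22]

/-- **`β(⅓,⅔) = (1/sin(π/3)) • x_π`** (`Γ(⅓)Γ(⅔) = 2π/√3` inside the rules). -/
theorem betaQ_reflection_third : betaQ (1 / 3) (2 / 3) = reflCoeff 1 3 • xPi := by
  have h := betaQ_reflection (p := 1) (n := 3) one_pos (by norm_num)
  norm_num at h
  exact h

/-- The coefficient at `(1,3)` is `2/√3`. -/
theorem coe_reflCoeff_one_three : ((reflCoeff 1 3 : K₀) : ℝ) = 2 / Real.sqrt 3 := by
  rw [coe_reflCoeff, show Real.pi * (((1:ℕ) : ℝ) / ((3:ℕ) : ℝ)) = Real.pi / 3 by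
    push_cast; ring, Real.sin_pi_div_three]
  have h3 : Real.sqrt 3 ≠ 0 := by positivity
  field_simp

end SoloBlind

end Summit.KontsevichZagierPeriods.KontsevichZagierPeriods.Theorems
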